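import Mathlib
import Summits.NavierStokesRegularity.NavierStokesRegularity.Theorems.TaoLadderRungTwoFlatBehindHop
import HarnessLib

/-!
# BEHIND TAIL 55 — L-55b: the (B1) behind clause from LARGE blocks only; the per-block BOTTOM-EDGE input of
  `R54.behindEnergyClause_hop_of_pseudoFlow` removed by a limit (helper for the K_A♭ parent item
  stmt-NavierStokesRegularity-22987 `FlatGapCertificatesV2`, child 2A `GradedAdiabaticWake` of route TaoLadderRungTwoFlat;
  cell harvest/h2-tao-ladder, theory-1 g43 ADDENDUM, memo BOTTOM-EDGE-55b / LADDER §55.9; TRAP-candidate #12 and its cure)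

PROVENANCE (p1 g23): theory-1 g43's image of record numT55/BehindTail55.lean sha16 c73b2dd98da91884 (farm `lean check`
rc 0 · 0 sorry · 0 warnings), landed with declarations BYTE-IDENTICAL (helper for the K_A♭ parent item
stmt-NavierStokesRegularity-22987; TRAP-candidate #12 cure L-55b: the hypothesis pair (`hE` with ONE `Ē` for every block
length `L ≥ 1`, `hbudget`) of p1's `R54.behindEnergyClause_hop_of_pseudoFlow` is not jointly dischargeable when a block's
bottom edge cuts the alive junk band; run the hop budget for LARGE `L` only, with an `L`-dependent bottom input that
vanishes with the deep clocks, and pass to the limit by monotonicity of the blocks in `L`); the image's module docstring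
follows verbatim.

# BEHIND TAIL 55 — L-55b: the (B1) clause from LARGE blocks only (TRAP-candidate #12, theory-1 g43)

Cell file (TAO-LADDER, theory-1 g43; MODEL lattice `T♭(ε)`; nothing about NS). Companion of
`BehindStart55.lean` (L-55a) and of p1's `R54.behindEnergyClause_hop_of_pseudoFlow`
(TaoLadderRungTwoFlatBehindHop, 05:42Z).

**The trap.** p1's block-level clause lemma asks, for EVERY block length `L ≥ 1`, for ONE constant `Ē`
dominating the weighted BOTTOM-edge flux `e^{θ'(1−L−σt)}|T_{−K−L}|` plus the top-edge flux. On the ALIVE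
junk band (entry depth `N₀+n ≤ depth ≤ d_*(ε₀)`, clocks `(1+ε₀)^{−5d/2}` still `O(1)`) the flux across a bond
INSIDE the junk is `≈ (1+ε)·clock·(0.2)³ ≈ 10⁻²` per unit time (the (K8) slosh of NUM-T54: two-shell gain
1.6–1.9/hop), and a block whose bottom edge cuts that band sees it with FULL weight (an edge term carries
`φ_bottom`, not the difference `φ_{k+1}−φ_k ≈ θ'φ_k` that tames internal slosh). So `Ē ≳ 10⁻²`, while the
transport removal is `θ'·s·W ≈ 2·10⁻⁴` per hop at `ε₀ = 10⁻²`: the per-block budget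
`e^{−μτ₁}V₀ + Ē(1−e^{−μτ₁})/μ ≤ a²W'` is then unprovable for mid-range `L` — for every `ε₀`.

**The cure (g42's "all blocks, L → ∞", typed).** Blocks are MONOTONE in `L` (`behindEnergy_mono`), and the
weighted bottom flux at depth `K+L` is `≤ (1+ε)Λ³·clock(−K−L) → 0` as `L → ∞` (deep clocks; `Λ` = the (B2)
cap during the hop). Hence it suffices to run p1's budget for LARGE `L` only, with input
`Ē_top + (1+ε)Λ³·clock(−K−L)`, and pass to the limit: EVERY block then obeys the TOP-INPUT-ONLY bound
`V_L(τ₁) ≤ e^{−μτ₁}V₀ + Ē_top(1−e^{−μτ₁})/μ` — no bottom-edge term at all (`behindEnergyClause_of_vanishing_bottomInput`).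
-/

noncomputable section

set_option linter.dupNamespace false

namespace Summit.NavierStokesRegularity.NavierStokesRegularity.Theorems.HopTube.R54

open Set Finset Literature.Analysis.FluidPDE Literature.Analysis.FluidPDE.TaoCascade MirrorPulse

/-- **L-55b (limit form of (B1))**: if the behind blocks of `z` are EVENTUALLY (in the block length `L`)
bounded by `W' + η` for every `η > 0`, then EVERY block is bounded by `W'` — blocks are monotone in `L`.
[cite: Tao2016AveragedNS, §4 (4.3); route TaoLadderRungTwoFlat, R54-1 (B1), cell LADDER §54.3/§55] -/
theorem behindEnergyClause_of_eventually_le {K : ℕ} {θ' W' : ℝ} {z : Fin 2 → ℤ → ℝ}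
    (h : ∀ η : ℝ, 0 < η → ∃ L₀ : ℕ, ∀ L : ℕ, L₀ ≤ L → behindEnergy K L θ' z ≤ W' + η) :
    BehindEnergyClause K θ' W' z := by
  intro L
  refine le_iff_forall_pos_le_add.mpr fun η hη => ?_
  obtain ⟨L₀, hL₀⟩ := h η hη
  exact (behindEnergy_mono K (le_max_left L L₀) θ' z).trans (hL₀ (max L L₀) (le_max_right L L₀))

/-- **L-55b (budget form)**: suppose the hop budget has been run for every LARGE block `L ≥ L₁` with an extra
(bottom-edge) input `c·η_L`, `c ≥ 0`, where `η_L → 0` (deep clocks). Then the landed state satisfies the (B1)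
clause with the TOP input only: the bottom edge never enters the schedule.
[cite: Tao2016AveragedNS, §4 (4.3); route TaoLadderRungTwoFlat, R54-1 (B1)/(B3), cell LADDER §55 (TRAP-candidate #12)] -/
theorem behindEnergyClause_of_vanishing_bottomInput {K L₁ : ℕ} {θ' W' c : ℝ} {z : Fin 2 → ℤ → ℝ}
    (hc : 0 ≤ c) (ηL : ℕ → ℝ) (hbound : ∀ L : ℕ, L₁ ≤ L → behindEnergy K L θ' z ≤ W' + c * ηL L)
    (hvanish : ∀ η : ℝ, 0 < η → ∃ L₀ : ℕ, ∀ L : ℕ, L₀ ≤ L → ηL L ≤ η) :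
    BehindEnergyClause K θ' W' z := by
  refine behindEnergyClause_of_eventually_le fun η hη => ?_
  obtain ⟨L₀, hL₀⟩ := hvanish (η / (c + 1)) (by positivity)
  refine ⟨max L₀ L₁, fun L hL => ?_⟩
  have h1 := hbound L ((le_max_right L₀ L₁).trans hL)
  have h2 := hL₀ L ((le_max_left L₀ L₁).trans hL)
  have h3 : c * ηL L ≤ c * (η / (c + 1)) := mul_le_mul_of_nonneg_left h2 hc
  have h4 : c * (η / (c + 1)) ≤ η := by
    rw [← mul_div_assoc, div_le_iff₀ (by positivity : (0 : ℝ) < c + 1)]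
    nlinarith
  linarith

/-- **Weighted bottom-edge flux of a block `L ≥ 1`** (the bottom term of p1's `hE`): with the (B2)-type cap
`|v_{−K−L}|, |a_{1−K−L}| ≤ Λ` during the hop and `0 ≤ σt`, the weight `e^{θ'(1−L−σt)} ≤ 1` and the flux is
cubic with the DEEP clock: `≤ (1+ε)·Λ³·clock ε₀ (−K−L)`.
[cite: Tao2016AveragedNS, §4 (4.1) (clock scaling), (4.3); route TaoLadderRungTwoFlat, (B2)+(L8b), cell LADDER §55] -/
theorem weighted_bottomFlux_le {ε ε₀ θ' σ Λ : ℝ} (hε : 0 ≤ ε) (hε₀ : -1 ≤ ε₀) (hθ : 0 ≤ θ') {K L : ℕ}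
    (hL : 1 ≤ L) (S : Fin 2 → ℤ → ℝ → ℝ) {t : ℝ} (hσt : 0 ≤ σ * t) (hΛ : 0 ≤ Λ)
    (h1 : |S 1 (1 - (K : ℤ) - L - 1) t| ≤ Λ) (h0 : |S 0 (1 - (K : ℤ) - L - 1 + 1) t| ≤ Λ) :
    Real.exp (θ' * ((((1 - (K : ℤ) - L : ℤ)) : ℝ) - (-(K : ℝ) + σ * t)))
        * |fluxT ε ε₀ S (1 - (K : ℤ) - L - 1) t|
      ≤ (1 + ε) * Λ ^ 3 * clock ε₀ (1 - (K : ℤ) - L - 1) := by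
  have hw : Real.exp (θ' * ((((1 - (K : ℤ) - L : ℤ)) : ℝ) - (-(K : ℝ) + σ * t))) ≤ 1 := by
    rw [Real.exp_le_one_iff]
    apply mul_nonpos_of_nonneg_of_nonpos hθ
    have hL' : (1 : ℝ) ≤ L := by exact_mod_cast hL
    push_cast
    linarith
  have hT := abs_fluxT_le hε hε₀ S (1 - (K : ℤ) - L - 1) t h1 h0
  have hc : 0 ≤ clock ε₀ (1 - (K : ℤ) - L - 1) := clock_nonneg hε₀ _
  have hprod : |S 1 (1 - (K : ℤ) - L - 1) t| * |S 0 (1 - (K : ℤ) - L - 1 + 1) t| ≤ Λ * Λ :=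
    mul_le_mul h1 h0 (abs_nonneg _) hΛ
  have hcoef : 0 ≤ clock ε₀ (1 - (K : ℤ) - L - 1) * ((1 + ε) * Λ) := mul_nonneg hc (by positivity)
  calc Real.exp (θ' * ((((1 - (K : ℤ) - L : ℤ)) : ℝ) - (-(K : ℝ) + σ * t)))
          * |fluxT ε ε₀ S (1 - (K : ℤ) - L - 1) t|
        ≤ 1 * |fluxT ε ε₀ S (1 - (K : ℤ) - L - 1) t| :=
          mul_le_mul_of_nonneg_right hw (abs_nonneg _)
    _ ≤ clock ε₀ (1 - (K : ℤ) - L - 1) * ((1 + ε) * Λ) * (Λ * Λ) := by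
          rw [one_mul]; exact hT.trans (mul_le_mul_of_nonneg_left hprod hcoef)
    _ = (1 + ε) * Λ ^ 3 * clock ε₀ (1 - (K : ℤ) - L - 1) := by ring

/-- **Deep clocks vanish**: for `0 < ε₀` the clock at the bottom edge of block `L` is
`(1+ε₀)^{−5(K+L)/2} ≤ (1+ε₀)^{−L} ≤ 1/(1+Lε₀) ≤ η` once `L ≥ 1/(ηε₀)` (Bernoulli).
[cite: Tao2016AveragedNS, §4 (4.1); route TaoLadderRungTwoFlat, cell LADDER §55 (TRAP-candidate #12)] -/
theorem clock_bottom_eventually_le {ε₀ : ℝ} (hε₀ : 0 < ε₀) (K : ℕ) (η : ℝ) (hη : 0 < η) :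
    ∃ L₀ : ℕ, ∀ L : ℕ, L₀ ≤ L → clock ε₀ (1 - (K : ℤ) - L - 1) ≤ η := by
  obtain ⟨L₀, hL₀⟩ := exists_nat_gt (1 / (η * ε₀))
  refine ⟨L₀, fun L hL => ?_⟩
  have hLgt : 1 / (η * ε₀) < (L : ℝ) := hL₀.trans_le (by exact_mod_cast hL)
  have hb : (1 : ℝ) ≤ 1 + ε₀ := by linarith
  have hexp : (5 : ℝ) * ((1 - (K : ℤ) - L - 1 : ℤ) : ℝ) / 2 ≤ -(L : ℝ) := by
    have hK : (0 : ℝ) ≤ K := Nat.cast_nonneg K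
    have hL' : (0 : ℝ) ≤ L := Nat.cast_nonneg L
    push_cast
    linarith
  have h1 : clock ε₀ (1 - (K : ℤ) - L - 1) ≤ (1 + ε₀) ^ (-(L : ℝ)) := by
    unfold clock
    exact Real.rpow_le_rpow_of_exponent_le hb hexp
  have h2 : (1 + ε₀) ^ (-(L : ℝ)) = ((1 + ε₀) ^ (L : ℕ))⁻¹ := by
    rw [Real.rpow_neg (by linarith), Real.rpow_natCast]
  have hbern : 1 + (L : ℝ) * ε₀ ≤ (1 + ε₀) ^ (L : ℕ) :=
    one_add_mul_le_pow (by linarith : (-2 : ℝ) ≤ ε₀) L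
  have hpos : 0 < 1 + (L : ℝ) * ε₀ := by positivity
  have h3 : ((1 + ε₀) ^ (L : ℕ))⁻¹ ≤ (1 + (L : ℝ) * ε₀)⁻¹ := inv_anti₀ hpos hbern
  have h4 : (1 + (L : ℝ) * ε₀)⁻¹ ≤ η := by
    rw [inv_le_comm₀ hpos hη]
    have hηε : η⁻¹ = 1 / (η * ε₀) * ε₀ := by field_simp
    have : η⁻¹ < (L : ℝ) * ε₀ := by rw [hηε]; exact mul_lt_mul_of_pos_right hLgt hε₀
    linarith
  calc clock ε₀ (1 - (K : ℤ) - L - 1) ≤ (1 + ε₀) ^ (-(L : ℝ)) := h1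
    _ = ((1 + ε₀) ^ (L : ℕ))⁻¹ := h2
    _ ≤ (1 + (L : ℝ) * ε₀)⁻¹ := h3
    _ ≤ η := h4

end Summit.NavierStokesRegularity.NavierStokesRegularity.Theorems.HopTube.R54
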